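import Literature.Analysis.FluidPDE.StretchedLayerStripCalculus
import HarnessLib

/-!
# The three integration-by-parts identities of the energy method on the period strip

Analysis/FluidPDE support file (everything proved, no definitions, no named facts). For curried
plane fields on the period strip `(0, L] × ℝ` (slice derivatives `StretchedLayer.dX/dY/lap` of
`StretchedLayerNS`, strip integrals `∫ q in Ioc 0 L ×ˢ univ, …`, tools of
`StretchedLayerStripCalculus`), the three identities of Majda–Bertozzi's basic energy estimate
(*Vorticity and Incompressible Flow*, CUP 2002, §3.1.1 p. 87, there on `ℝᴺ` for decaying fields;
here on the period strip of an `x`-periodic flow whose perturbation decays across the layer,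
cf. the Remark after Prop. 3.4, p. 93), with the strain drift `−γy ∂_y` of the stretched layer
system built in:

* `integral_strip_transport`: for a divergence-free transporting field `(U, V)` and a scalar
  `φ`, all `C¹` and `L`-periodic in `x`,
  `∫∫ (U ∂ₓφ + (V − γy) ∂_yφ) = γ ∫∫ φ` (the drift `(U, V − γy)` has divergence `−γ`);
* `integral_strip_pressure_eq_zero`: for a divergence-free `C¹` field `(a, b)` and a `C¹`
  pressure `p`, `L`-periodic in `x`, `∫∫ (a ∂ₓp + b ∂_yp) = −∫∫ p (∂ₓa + ∂_yb) = 0`;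
* `integral_strip_mul_lap_self_nonpos`: for a `C²` field `a`, `L`-periodic in `x`, decaying
  across the layer together with `∂ₓa` like `e^{−k|y|}` and with bounded `∂_ya, ∂ₓ∂ₓa, ∂_y∂_ya`,
  `∫∫ a Δa ≤ 0` (no integrability of `|∇a|²` is presupposed: the `y`-integration by parts is the
  one-sided `integral_strip_mul_dYdY_self_nonpos`);
* the slice derivatives of the energy density `½(a² + b²)`.

Integrability of the various products is taken as hypotheses in the first two identities (the
caller derives it from decay across the layer, `integrableOn_strip_of_abs_le_sq_exp`) and derived
from the stated bounds in the third. All statements are folklore calculus.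
-/

noncomputable section

open Set Function Filter
open _root_.MeasureTheory
open scoped Topology

namespace Literature.Analysis.FluidPDE

namespace StretchedLayer

/-! ### The energy density `½(a² + b²)` -/

/-- `∂ₓ ½(a² + b²) = a ∂ₓa + b ∂ₓb` where the `x`-slices are differentiable. [folklore] -/
theorem dX_half_sq_add_sq {a b : ℝ → ℝ → ℝ} {x y : ℝ}
    (ha : DifferentiableAt ℝ (fun s => a s y) x) (hb : DifferentiableAt ℝ (fun s => b s y) x) :
    dX (fun r s => (a r s * a r s + b r s * b r s) / 2) x y =
      a x y * dX a x y + b x y * dX b x y := by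
  have h : HasDerivAt (fun s => (a s y * a s y + b s y * b s y) / 2)
      ((deriv (fun s => a s y) x * a x y + a x y * deriv (fun s => a s y) x +
        (deriv (fun s => b s y) x * b x y + b x y * deriv (fun s => b s y) x)) / 2) x :=
    ((ha.hasDerivAt.mul ha.hasDerivAt).add (hb.hasDerivAt.mul hb.hasDerivAt)).div_const 2
  rw [dX, h.deriv, dX, dX]
  ring

/-- `∂_y ½(a² + b²) = a ∂_ya + b ∂_yb` where the `y`-slices are differentiable. [folklore] -/
theorem dY_half_sq_add_sq {a b : ℝ → ℝ → ℝ} {x y : ℝ}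
    (ha : DifferentiableAt ℝ (fun s => a x s) y) (hb : DifferentiableAt ℝ (fun s => b x s) y) :
    dY (fun r s => (a r s * a r s + b r s * b r s) / 2) x y =
      a x y * dY a x y + b x y * dY b x y := by
  have h : HasDerivAt (fun s => (a x s * a x s + b x s * b x s) / 2)
      ((deriv (fun s => a x s) y * a x y + a x y * deriv (fun s => a x s) y +
        (deriv (fun s => b x s) y * b x y + b x y * deriv (fun s => b x s) y)) / 2) y :=
    ((ha.hasDerivAt.mul ha.hasDerivAt).add (hb.hasDerivAt.mul hb.hasDerivAt)).div_const 2
  rw [dY, h.deriv, dY, dY]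
  ring

/-- The energy density of `C¹` fields is `C¹`. [folklore] -/
theorem contDiff_half_sq_add_sq {a b : ℝ → ℝ → ℝ} {n : WithTop ℕ∞}
    (ha : ContDiff ℝ n (fun q : ℝ × ℝ => a q.1 q.2))
    (hb : ContDiff ℝ n (fun q : ℝ × ℝ => b q.1 q.2)) :
    ContDiff ℝ n (fun q : ℝ × ℝ => (a q.1 q.2 * a q.1 q.2 + b q.1 q.2 * b q.1 q.2) / 2) :=
  ((ha.mul ha).add (hb.mul hb)).div_const 2

/-! ### Transport: the drift `(U, V − γy)` has divergence `−γ` -/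

/-- **Transport identity on the period strip.** For `C¹` plane fields `U, V, φ` with
`∂ₓU + ∂_yV = 0`, `U` and `φ` `L`-periodic in `x` (`0 ≤ L`), and the five products below
integrable on the strip,
`∫∫_{(0,L]×ℝ} (U ∂ₓφ + (V − γy) ∂_yφ) = γ ∫∫_{(0,L]×ℝ} φ`:
integrate by parts in `x` (periodicity) and in `y`; `div (U, V − γy) = −γ`
(Majda–Bertozzi 2002, §3.1.1 p. 87, transport term, with the strain drift of §1.4 added).
[folklore] -/
theorem integral_strip_transport {L γ : ℝ} (hL : 0 ≤ L) {U V φ : ℝ → ℝ → ℝ}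
    (hU : ContDiff ℝ 1 (fun q : ℝ × ℝ => U q.1 q.2))
    (hV : ContDiff ℝ 1 (fun q : ℝ × ℝ => V q.1 q.2))
    (hφ : ContDiff ℝ 1 (fun q : ℝ × ℝ => φ q.1 q.2))
    (hdiv : ∀ x y, dX U x y + dY V x y = 0)
    (hperU : ∀ x y, U (x + L) y = U x y) (hperφ : ∀ x y, φ (x + L) y = φ x y)
    (hI1 : IntegrableOn (fun q : ℝ × ℝ => U q.1 q.2 * dX φ q.1 q.2) (Ioc 0 L ×ˢ univ))
    (hI2 : IntegrableOn (fun q : ℝ × ℝ => dX U q.1 q.2 * φ q.1 q.2) (Ioc 0 L ×ˢ univ))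
    (hI3 : IntegrableOn (fun q : ℝ × ℝ => (V q.1 q.2 - γ * q.2) * dY φ q.1 q.2) (Ioc 0 L ×ˢ univ))
    (hI4 : IntegrableOn (fun q : ℝ × ℝ => (dY V q.1 q.2 - γ) * φ q.1 q.2) (Ioc 0 L ×ˢ univ))
    (hI5 : IntegrableOn (fun q : ℝ × ℝ => (V q.1 q.2 - γ * q.2) * φ q.1 q.2) (Ioc 0 L ×ˢ univ)) :
    ∫ q in Ioc 0 L ×ˢ univ, (U q.1 q.2 * dX φ q.1 q.2 + (V q.1 q.2 - γ * q.2) * dY φ q.1 q.2) =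
      γ * ∫ q in Ioc 0 L ×ˢ univ, φ q.1 q.2 := by
  have hx : ∫ q in Ioc 0 L ×ˢ univ, U q.1 q.2 * dX φ q.1 q.2 =
      -∫ q in Ioc 0 L ×ˢ univ, dX U q.1 q.2 * φ q.1 q.2 :=
    integral_strip_mul_dX_eq_neg hL (hasDerivAt_dX_of_contDiff hU one_ne_zero)
      (hasDerivAt_dX_of_contDiff hφ one_ne_zero)
      (continuous_slice_x (continuous_dX hU)) (continuous_slice_x (continuous_dX hφ))
      (fun y => by
        rw [show U L y = U 0 y by simpa using hperU 0 y,
          show φ L y = φ 0 y by simpa using hperφ 0 y]) hI1 hI2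
  have hdV : ∀ x y, HasDerivAt (fun s => V x s - γ * s) (dY V x y - γ) y := fun x y =>
    ((hasDerivAt_dY_of_contDiff hV one_ne_zero x y).sub
      ((hasDerivAt_id y).const_mul γ)).congr_deriv (by rw [mul_one])
  have hy : ∫ q in Ioc 0 L ×ˢ univ, (V q.1 q.2 - γ * q.2) * dY φ q.1 q.2 =
      -∫ q in Ioc 0 L ×ˢ univ, (dY V q.1 q.2 - γ) * φ q.1 q.2 :=
    integral_strip_mul_dY_eq_neg (f := fun x y => V x y - γ * y) (f' := fun x y => dY V x y - γ)
      hdV (hasDerivAt_dY_of_contDiff hφ one_ne_zero) hI3 hI4 hI5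
  calc ∫ q in Ioc 0 L ×ˢ univ, (U q.1 q.2 * dX φ q.1 q.2 + (V q.1 q.2 - γ * q.2) * dY φ q.1 q.2)
      = (∫ q in Ioc 0 L ×ˢ univ, U q.1 q.2 * dX φ q.1 q.2) +
          ∫ q in Ioc 0 L ×ˢ univ, (V q.1 q.2 - γ * q.2) * dY φ q.1 q.2 := integral_add hI1 hI3
    _ = -((∫ q in Ioc 0 L ×ˢ univ, dX U q.1 q.2 * φ q.1 q.2) +
          ∫ q in Ioc 0 L ×ˢ univ, (dY V q.1 q.2 - γ) * φ q.1 q.2) := by rw [hx, hy]; ring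
    _ = -∫ q in Ioc 0 L ×ˢ univ, (dX U q.1 q.2 * φ q.1 q.2 + (dY V q.1 q.2 - γ) * φ q.1 q.2) := by
        rw [integral_add hI2 hI4]
    _ = -∫ q in Ioc 0 L ×ˢ univ, (-γ) * φ q.1 q.2 := by
        congr 1
        refine integral_congr_ae (Eventually.of_forall fun q => ?_)
        have h := hdiv q.1 q.2
        simp only
        linear_combination (φ q.1 q.2) * h
    _ = γ * ∫ q in Ioc 0 L ×ˢ univ, φ q.1 q.2 := by rw [MeasureTheory.integral_const_mul]; ring

/-! ### Pressure: `∫∫ (a, b)·∇p = 0` for divergence-free `(a, b)` -/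

/-- **The pressure term drops out on the period strip.** For `C¹` plane fields `a, b, p` with
`∂ₓa + ∂_yb = 0`, `a` and `p` `L`-periodic in `x` (`0 ≤ L`), and the five products below
integrable on the strip, `∫∫_{(0,L]×ℝ} (a ∂ₓp + b ∂_yp) = 0`
(Majda–Bertozzi 2002, §3.1.1 p. 87: `−(∇p̃, ṽ) = (p̃, div ṽ) = 0`). [folklore] -/
theorem integral_strip_pressure_eq_zero {L : ℝ} (hL : 0 ≤ L) {a b p : ℝ → ℝ → ℝ}
    (ha : ContDiff ℝ 1 (fun q : ℝ × ℝ => a q.1 q.2))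
    (hb : ContDiff ℝ 1 (fun q : ℝ × ℝ => b q.1 q.2))
    (hp : ContDiff ℝ 1 (fun q : ℝ × ℝ => p q.1 q.2))
    (hdiv : ∀ x y, dX a x y + dY b x y = 0)
    (hpera : ∀ x y, a (x + L) y = a x y) (hperp : ∀ x y, p (x + L) y = p x y)
    (hI1 : IntegrableOn (fun q : ℝ × ℝ => a q.1 q.2 * dX p q.1 q.2) (Ioc 0 L ×ˢ univ))
    (hI2 : IntegrableOn (fun q : ℝ × ℝ => dX a q.1 q.2 * p q.1 q.2) (Ioc 0 L ×ˢ univ))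
    (hI3 : IntegrableOn (fun q : ℝ × ℝ => b q.1 q.2 * dY p q.1 q.2) (Ioc 0 L ×ˢ univ))
    (hI4 : IntegrableOn (fun q : ℝ × ℝ => dY b q.1 q.2 * p q.1 q.2) (Ioc 0 L ×ˢ univ))
    (hI5 : IntegrableOn (fun q : ℝ × ℝ => b q.1 q.2 * p q.1 q.2) (Ioc 0 L ×ˢ univ)) :
    ∫ q in Ioc 0 L ×ˢ univ, (a q.1 q.2 * dX p q.1 q.2 + b q.1 q.2 * dY p q.1 q.2) = 0 := by
  have hx : ∫ q in Ioc 0 L ×ˢ univ, a q.1 q.2 * dX p q.1 q.2 =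
      -∫ q in Ioc 0 L ×ˢ univ, dX a q.1 q.2 * p q.1 q.2 :=
    integral_strip_mul_dX_eq_neg hL (hasDerivAt_dX_of_contDiff ha one_ne_zero)
      (hasDerivAt_dX_of_contDiff hp one_ne_zero)
      (continuous_slice_x (continuous_dX ha)) (continuous_slice_x (continuous_dX hp))
      (fun y => by
        rw [show a L y = a 0 y by simpa using hpera 0 y,
          show p L y = p 0 y by simpa using hperp 0 y]) hI1 hI2
  have hy : ∫ q in Ioc 0 L ×ˢ univ, b q.1 q.2 * dY p q.1 q.2 =
      -∫ q in Ioc 0 L ×ˢ univ, dY b q.1 q.2 * p q.1 q.2 :=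
    integral_strip_mul_dY_eq_neg (hasDerivAt_dY_of_contDiff hb one_ne_zero)
      (hasDerivAt_dY_of_contDiff hp one_ne_zero) hI3 hI4 hI5
  calc ∫ q in Ioc 0 L ×ˢ univ, (a q.1 q.2 * dX p q.1 q.2 + b q.1 q.2 * dY p q.1 q.2)
      = (∫ q in Ioc 0 L ×ˢ univ, a q.1 q.2 * dX p q.1 q.2) +
          ∫ q in Ioc 0 L ×ˢ univ, b q.1 q.2 * dY p q.1 q.2 := integral_add hI1 hI3
    _ = -((∫ q in Ioc 0 L ×ˢ univ, dX a q.1 q.2 * p q.1 q.2) +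
          ∫ q in Ioc 0 L ×ˢ univ, dY b q.1 q.2 * p q.1 q.2) := by rw [hx, hy]; ring
    _ = -∫ q in Ioc 0 L ×ˢ univ, (dX a q.1 q.2 * p q.1 q.2 + dY b q.1 q.2 * p q.1 q.2) := by
        rw [integral_add hI2 hI4]
    _ = -∫ q in Ioc 0 L ×ˢ univ, (0 : ℝ) := by
        congr 1
        refine integral_congr_ae (Eventually.of_forall fun q => ?_)
        have h := hdiv q.1 q.2
        simp only
        linear_combination (p q.1 q.2) * h
    _ = 0 := by rw [integral_zero, neg_zero]

/-! ### Viscosity: `∫∫ a Δa ≤ 0` for a field decaying across the layer -/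

/-- **The viscous term is dissipative on the period strip.** For a `C²` plane field `a`,
`L`-periodic in `x` (`0 ≤ L`), with `|a|, |∂ₓa| ≤ A e^{−k|y|}` (`k > 0`, `A ≥ 0`) and
`|∂_ya| + |∂ₓ∂ₓa| + |∂_y∂_ya| ≤ B`, `∫∫_{(0,L]×ℝ} a Δa ≤ 0`
(Majda–Bertozzi 2002, §3.1.1 p. 87–88: `∫ Δṽ ṽ = −∫|∇ṽ|² ≤ 0`; here `∫∫ a ∂ₓ∂ₓa = −∫∫ (∂ₓa)²`
by periodicity and `∫∫ a ∂_y∂_ya ≤ 0` by the one-sided integration by parts across the layer,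
the boundary term `a ∂_ya` decaying). [folklore] -/
theorem integral_strip_mul_lap_self_nonpos {L : ℝ} (hL : 0 ≤ L) {a : ℝ → ℝ → ℝ}
    (ha : ContDiff ℝ 2 (fun q : ℝ × ℝ => a q.1 q.2)) (hper : ∀ x y, a (x + L) y = a x y)
    {k A B : ℝ} (hk : 0 < k) (hA : 0 ≤ A)
    (h0 : ∀ x y, |a x y| ≤ A * Real.exp (-k * |y|))
    (h1 : ∀ x y, |dX a x y| ≤ A * Real.exp (-k * |y|))
    (h2 : ∀ x y, |dY a x y| + |dX (dX a) x y| + |dY (dY a) x y| ≤ B) :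
    ∫ q in Ioc 0 L ×ˢ univ, a q.1 q.2 * lap a q.1 q.2 ≤ 0 := by
  have ha1 : ContDiff ℝ 1 (fun q : ℝ × ℝ => a q.1 q.2) := ha.of_le one_le_two
  have hxa : ContDiff ℝ 1 (fun q : ℝ × ℝ => dX a q.1 q.2) := contDiff_one_dX ha
  have hya : ContDiff ℝ 1 (fun q : ℝ × ℝ => dY a q.1 q.2) := contDiff_one_dY ha
  have hac : Continuous (fun q : ℝ × ℝ => a q.1 q.2) := ha.continuous
  have hB : 0 ≤ B := le_trans (by positivity) (h2 0 0)
  have hyy : ∀ x y, |dY (dY a) x y| ≤ B := fun x y => by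
    have := h2 x y; linarith [abs_nonneg (dY a x y), abs_nonneg (dX (dX a) x y)]
  have hxx : ∀ x y, |dX (dX a) x y| ≤ B := fun x y => by
    have := h2 x y; linarith [abs_nonneg (dY a x y), abs_nonneg (dY (dY a) x y)]
  have hy1 : ∀ x y, |dY a x y| ≤ B := fun x y => by
    have := h2 x y; linarith [abs_nonneg (dX (dX a) x y), abs_nonneg (dY (dY a) x y)]
  -- integrability of `a ∂ₓ∂ₓa`, `(∂ₓa)²`, `a ∂_y∂_ya`
  have hI1 : IntegrableOn (fun q : ℝ × ℝ => a q.1 q.2 * dX (dX a) q.1 q.2) (Ioc 0 L ×ˢ univ) :=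
    integrableOn_strip_of_abs_le_exp (hac.mul (continuous_dXdX ha)) (mul_nonneg hA hB) hk
      fun x _ y => by
        rw [abs_mul]
        calc |a x y| * |dX (dX a) x y| ≤ A * Real.exp (-k * |y|) * B :=
              mul_le_mul (h0 x y) (hxx x y) (abs_nonneg _) (by positivity)
          _ = A * B * Real.exp (-k * |y|) := by ring
  have hI2 : IntegrableOn (fun q : ℝ × ℝ => dX a q.1 q.2 * dX a q.1 q.2) (Ioc 0 L ×ˢ univ) :=
    integrableOn_strip_of_abs_le_exp ((continuous_dX ha1).mul (continuous_dX ha1))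
      (mul_nonneg hA hA) hk fun x _ y => by
        rw [abs_mul]
        have hA1 : |dX a x y| ≤ A := (h1 x y).trans (mul_le_of_le_one_right hA
          (Real.exp_le_one_iff.2 (by nlinarith [abs_nonneg y])))
        calc |dX a x y| * |dX a x y| ≤ A * (A * Real.exp (-k * |y|)) :=
              mul_le_mul hA1 (h1 x y) (abs_nonneg _) hA
          _ = A * A * Real.exp (-k * |y|) := by ring
  have hI3 : IntegrableOn (fun q : ℝ × ℝ => a q.1 q.2 * dY (dY a) q.1 q.2) (Ioc 0 L ×ˢ univ) :=
    integrableOn_strip_of_abs_le_exp (hac.mul (continuous_dYdY ha)) (mul_nonneg hA hB) hk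
      fun x _ y => by
        rw [abs_mul]
        calc |a x y| * |dY (dY a) x y| ≤ A * Real.exp (-k * |y|) * B :=
              mul_le_mul (h0 x y) (hyy x y) (abs_nonneg _) (by positivity)
          _ = A * B * Real.exp (-k * |y|) := by ring
  -- the boundary term `a ∂_ya → 0` across the layer
  have hbd : ∀ x y, |a x y * dY a x y| ≤ A * B * Real.exp (-k * |y|) := fun x y => by
    rw [abs_mul]
    calc |a x y| * |dY a x y| ≤ A * Real.exp (-k * |y|) * B :=
          mul_le_mul (h0 x y) (hy1 x y) (abs_nonneg _) (by positivity)
      _ = A * B * Real.exp (-k * |y|) := by ring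
  have hX : ∫ q in Ioc 0 L ×ˢ univ, a q.1 q.2 * dX (dX a) q.1 q.2 ≤ 0 :=
    integral_strip_mul_dXdX_self_nonpos hL (hasDerivAt_dX_of_contDiff ha two_ne_zero)
      (hasDerivAt_dX_of_contDiff hxa one_ne_zero) (continuous_slice_x (continuous_dX ha1))
      (continuous_slice_x (continuous_dXdX ha))
      (fun y => by
        rw [show a L y = a 0 y by simpa using hper 0 y,
          show dX a L y = dX a 0 y by simpa using dX_periodic hper 0 y]) hI1 hI2
  have hY : ∫ q in Ioc 0 L ×ˢ univ, a q.1 q.2 * dY (dY a) q.1 q.2 ≤ 0 :=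
    integral_strip_mul_dYdY_self_nonpos (hasDerivAt_dY_of_contDiff ha two_ne_zero)
      (hasDerivAt_dY_of_contDiff hya one_ne_zero) (continuous_slice_y (continuous_dYdY ha)) hI3
      (fun x => tendsto_zero_atTop_of_abs_le_exp hk (hbd x))
      (fun x => tendsto_zero_atBot_of_abs_le_exp hk (hbd x))
  have hsplit : ∫ q in Ioc 0 L ×ˢ univ, a q.1 q.2 * lap a q.1 q.2 =
      (∫ q in Ioc 0 L ×ˢ univ, a q.1 q.2 * dX (dX a) q.1 q.2) +
        ∫ q in Ioc 0 L ×ˢ univ, a q.1 q.2 * dY (dY a) q.1 q.2 := by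
    rw [← integral_add hI1 hI3]
    refine integral_congr_ae (Eventually.of_forall fun q => ?_)
    simp only [lap_apply]
    ring
  rw [hsplit]
  linarith

end StretchedLayer

end Literature.Analysis.FluidPDE
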